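import Summits.CriticalPhenomena.PercolationContinuityZ3.Theorems.PercNearOneGluingAdditiveGluingThreeRelaysAssembly
import Summits.CriticalPhenomena.PercolationContinuityZ3.Theorems.PercNearOneGluingAdditiveGluingTieReductionPointwise
import HarnessLib

/-! # Crux `PercNearOneGluing.AdditiveGluing` (stmt-CriticalPhenomena-4576): three relays — the bad-region certificate (T1)
# is only needed ON THE TIE LOCUS `τ(a₁) = τ(a₃)`

Support file (`--supports stmt-CriticalPhenomena-4576`, lead prim-png-lead-4576, line `starglue`).  No definitions, no named facts,
no sorries.  Combines deep seat r2's three-relay assembly (`…ThreeRelaysRegion/Assembly`: `AdditiveGluing` for `(A.erase b).card ≤ 3`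
⟸ the bad-region certificate (T1) = registered stub `stub_regionCertThreeRelays_d2`) with the minimiser-tie reduction
(`additiveGluing_pointwise_of_minTie`, Kozma–Nitzan §5.3 run on the minimiser): by one-edge affine interpolation it suffices to
prove the inequality at weight functions where the two least reliable relays TIE, so (T1) is only needed with the extra hypothesis
`μ(a₁ ↔ b) ≤ μ(a₃ ↔ b)` (hence `= `, `a₃` being worst), i.e. when BOTH `a₁` and `a₃` are worst relays:

* `additiveGluing_threeRelays_of_tieRegionCert` — r2's `additiveGluing_threeRelays_of_regionCert` with the certificate assumed only
  on the tie locus and the instance assumed on it (cases `τ(o) ≥ τ₃` trivial, `m₃ ≤ m₁₂` = KN Theorem 2 (`knThm2_core`), else the certificate);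
* `additiveGluing_of_erase_card_le_three_of_tieRegionCert` — `AdditiveGluing` for every `A` with `(A.erase b).card ≤ 3` from the
  tie-locus certificate (T1-tie); this is what the skeleton v11 consumes (stub `stub_regionCertThreeRelaysTie_pl`).
[cite: KozmaNitzan2024, Theorem 2 (§3.2, pp. 8–9), §5.3 (p. 34)]
-/

namespace Summit.CriticalPhenomena.PercolationContinuityZ3.Theorems

open MeasureTheory Set Literature.Probability.LatticeModels Literature.Probability.Percolation

noncomputable section
open Classical

variable {n : ℕ}

/-- **Three relays on the tie locus, from the tie-locus certificate.**  If (T1) holds whenever `a₃` AND `a₁` are worst relays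
(`τ₁ = τ₃ ≤ τ₂`), `τ(o) < τ₃` and `m₁₂ < m₃`, then for three distinct relays with `τ₃ ≤ τ₁ ≤ τ₃`, `τ₃ ≤ τ₂` and `μ(aᵢ ↔ b) ≥ 1 − t`:
`μ({o ↔ A} ∖ {o ↔ b}) ≤ t`.  Cases as in `additiveGluing_threeRelays_of_regionCert` (deep seat r2).
[cite: KozmaNitzan2024, Theorem 2 (§3.2, pp. 8–9)] -/
theorem additiveGluing_threeRelays_of_tieRegionCert
    (hcert : ∀ (n : ℕ) (w : Sym2 (Fin n) → unitInterval) (o b a₁ a₂ a₃ : Fin n), a₁ ≠ a₂ → a₁ ≠ a₃ → a₂ ≠ a₃ → (prodBernoulli w).real (openConn a₃ b) ≤ (prodBernoulli w).real (openConn a₁ b) → (prodBernoulli w).real (openConn a₃ b) ≤ (prodBernoulli w).real (openConn a₂ b) → (prodBernoulli w).real (openConn a₁ b) ≤ (prodBernoulli w).real (openConn a₃ b) → (prodBernoulli w).real (openConn o b) < (prodBernoulli w).real (openConn a₃ b) → (prodBernoulli w).real ((openConn a₁ a₃)ᶜ ∩ (openConn a₂ a₃)ᶜ ∩ (openConn a₁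 b ∩ openConn a₂ b)) < (prodBernoulli w).real ((openConn a₁ a₃)ᶜ ∩ (openConn a₂ a₃)ᶜ ∩ openConn a₃ b) → 0 ≤ (prodBernoulli w).real ((openConn a₁ a₃)ᶜ ∩ (openConn a₂ a₃)ᶜ ∩ (openConn a₁ o ∪ openConn a₂ o)) * (prodBernoulli w).real ((openConn a₁ a₂)ᶜ ∩ (openConn a₁ a₃)ᶜ : Set (BondConfig (Fin n))) * (prodBernoulli w).real ((openConn a₂ a₁)ᶜ ∩ (openConn a₂ a₃)ᶜ : Set (BondConfig (Fin n))) * ((prodBernoulli w).real ((openConn a₁ a₃)ᶜ ∩ (openConn a₂ a₃)ᶜ ∩ (openConn a₁ b ∩ openConn a₂ b)) - (prodBernoulli w).real ((openConn a₁ a₃)ᶜ ∩ (openConn a₂ a₃)ᶜ ∩ openConn a₃ b)) + (prodBernoulli w).real ((openConn a₁ a₂)ᶜ ∩ (openConn a₁ a₃)ᶜ ∩ openConn a₁ o) * (prodBernoulli w).real ((openConn a₁ a₃)ᶜ ∩ (openConn a₂ a₃)ᶜ : Set (BondConfig (Fin n))) * (prodBernoulli w).real ((openConn a₂ a₁)ᶜ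 ∩ (openConn a₂ a₃)ᶜ : Set (BondConfig (Fin n))) * ((prodBernoulli w).real ((openConn a₁ a₂)ᶜ ∩ (openConn a₁ a₃)ᶜ ∩ openConn a₁ b) - (prodBernoulli w).real ((openConn a₁ a₂)ᶜ ∩ (openConn a₁ a₃)ᶜ ∩ (openConn a₂ b ∩ openConn a₃ b))) + (prodBernoulli w).real ((openConn a₂ a₁)ᶜ ∩ (openConn a₂ a₃)ᶜ ∩ openConn a₂ o) * (prodBernoulli w).real ((openConn a₁ a₃)ᶜ ∩ (openConn a₂ a₃)ᶜ : Set (BondConfig (Fin n))) * (prodBernoulli w).real ((openConn a₁ a₂)ᶜ ∩ (openConn a₁ a₃)ᶜ : Set (BondConfig (Fin n))) * ((prodBernoulli w).real ((openConn a₂ a₁)ᶜ ∩ (openConn a₂ a₃)ᶜ ∩ openConn a₂ b) - (prodBernoulli w).real ((openConn a₂ a₁)ᶜ ∩ (openConn a₂ a₃)ᶜ ∩ (openConn a₁ b ∩ openConn a₃ b))) + (prodBernoulli w).real ((openConn a₁ a₂)ᶜ ∩ (openConn a₁ a₃)ᶜ : Set (BondConfig (Fin n))) * (prodBernoulli w).real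 ((openConn a₂ a₁)ᶜ ∩ (openConn a₂ a₃)ᶜ : Set (BondConfig (Fin n))) * (prodBernoulli w).real ((openConn a₁ a₃)ᶜ ∩ (openConn a₂ a₃)ᶜ : Set (BondConfig (Fin n))) * (prodBernoulli w).real ((openConn o a₁ ∪ openConn o a₂ ∪ openConn o a₃)ᶜ ∩ (openConn a₃ b)ᶜ : Set (BondConfig (Fin n)))) :
    ∀ (n : ℕ) (w : Sym2 (Fin n) → unitInterval) (o b a₁ a₂ a₃ : Fin n) (t : ℝ),
      a₁ ≠ a₂ → a₁ ≠ a₃ → a₂ ≠ a₃ →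
      1 - t ≤ (prodBernoulli w).real (openConn a₃ b) →
      (prodBernoulli w).real (openConn a₃ b) ≤ (prodBernoulli w).real (openConn a₁ b) →
      (prodBernoulli w).real (openConn a₃ b) ≤ (prodBernoulli w).real (openConn a₂ b) →
      (prodBernoulli w).real (openConn a₁ b) ≤ (prodBernoulli w).real (openConn a₃ b) →
      (prodBernoulli w).real ((openConn o a₁ ∪ openConn o a₂ ∪ openConn o a₃) \ openConn o b) ≤ t := by
  intro n w o b a₁ a₂ a₃ t h12 h13 h23 hτ3 hτ31 hτ32 htie
  have hm : ∀ s : Set (BondConfig (Fin n)), MeasurableSet s := fun _ => MeasurableSet.of_discrete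
  have hc3 : (prodBernoulli w).real ((openConn a₃ b)ᶜ : Set (BondConfig (Fin n))) =
      1 - (prodBernoulli w).real (openConn a₃ b : Set (BondConfig (Fin n))) := probReal_compl_eq_one_sub (hm _)
  suffices hE : (prodBernoulli w).real ((openConn o a₁ ∪ openConn o a₂ ∪ openConn o a₃) \ openConn o b) ≤
      (prodBernoulli w).real ((openConn a₃ b)ᶜ : Set (BondConfig (Fin n))) by linarith
  by_cases hob : (prodBernoulli w).real (openConn a₃ b) ≤ (prodBernoulli w).real (openConn o b)
  · have hco : (prodBernoulli w).real ((openConn o b)ᶜ : Set (BondConfig (Fin n))) =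
        1 - (prodBernoulli w).real (openConn o b : Set (BondConfig (Fin n))) := probReal_compl_eq_one_sub (hm _)
    have hsub : (prodBernoulli w).real ((openConn o a₁ ∪ openConn o a₂ ∪ openConn o a₃) \ openConn o b) ≤
        (prodBernoulli w).real ((openConn o b)ᶜ : Set (BondConfig (Fin n))) :=
      measureReal_mono (fun ω hω => hω.2)
    linarith
  · push Not at hob
    by_cases hgood : (prodBernoulli w).real (openConn b a₃ ∩ (openConn b a₁)ᶜ ∩ (openConn b a₂)ᶜ) ≤
        (prodBernoulli w).real (openConn b a₁ ∩ openConn b a₂ ∩ (openConn b a₃)ᶜ)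
    · have hX := knThm2_core stub_bhkSets.1 stub_bhkSets.2 (stub_knLemma2 stub_bhkSets) w o b a₁ a₂ a₃
        h12 h13 h23 hτ31 hτ32 hgood
      have h1 := measureReal_inter_add_sdiff (μ := prodBernoulli w)
        (s := openConn o a₁ ∪ openConn o a₂ ∪ openConn o a₃) (hm (openConn o b))
      have h2 := measureReal_inter_add_sdiff (μ := prodBernoulli w)
        (s := openConn o a₁ ∪ openConn o a₂ ∪ openConn o a₃) (hm (openConn a₃ b))
      have h3 : (prodBernoulli w).real ((openConn o a₁ ∪ openConn o a₂ ∪ openConn o a₃) \ openConn a₃ b) ≤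
          (prodBernoulli w).real ((openConn a₃ b)ᶜ : Set (BondConfig (Fin n))) :=
        measureReal_mono fun ω hω => hω.2
      linarith
    · push Not at hgood
      rw [knThm2_m3, knThm2_m12] at hgood
      exact knThm2_region_eform stub_bhkSets.1 stub_bhkSets.2 w o b a₁ a₂ a₃ h12 h13 h23 hτ31 hτ32 hgood
        (hcert n w o b a₁ a₂ a₃ h12 h13 h23 hτ31 hτ32 htie hob hgood)

/-- On `{c ↔ b}` almost surely, `{o ↔ c} ∖ {o ↔ b}` is null: `μ(o↔c ∖ o↔b) ≤ μ(c ↮ b) = 1 − μ(c ↔ b)`. [folklore] -/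
theorem tieRed_sdiff_le_one_sub (w : Sym2 (Fin n) → unitInterval) (o c b : Fin n) :
    (prodBernoulli w).real ((openConn o c : Set (BondConfig (Fin n))) \ openConn o b) ≤
      1 - (prodBernoulli w).real (openConn c b : Set (BondConfig (Fin n))) := by
  have hm : ∀ s : Set (BondConfig (Fin n)), MeasurableSet s := fun _ => MeasurableSet.of_discrete
  rw [← probReal_compl_eq_one_sub (hm _)]
  refine measureReal_mono ?_ (measure_ne_top _ _)
  rintro ω ⟨hoc, hob⟩ hcb
  exact hob ((show (openGraph ω).Reachable o c from hoc).trans hcb)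

/-- **`AdditiveGluing` for at most three relays besides the target, from the TIE-LOCUS certificate (T1-tie).**  By the pointwise
minimiser-tie reduction it suffices to treat weight functions with a tie at the minimum of `μ(·↔b)` on `A`; if the minimum is `1`
every relay is a.s. joined to `b` and the claim is a union bound; otherwise the two tied minimal relays are distinct from `b`, and with
at most two relays the landed two-relay theorems apply, while with three relays `x = a₁` (tied), `y = a₂`, `z = a₃` (minimal) the
tie-locus three-relay E-form applies. [cite: KozmaNitzan2024, Conjecture 1 (p. 3), Theorem 2 (§3.2), §5.3] -/
theorem additiveGluing_of_erase_card_le_three_of_tieRegionCert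
    (hcert : ∀ (n : ℕ) (w : Sym2 (Fin n) → unitInterval) (o b a₁ a₂ a₃ : Fin n), a₁ ≠ a₂ → a₁ ≠ a₃ → a₂ ≠ a₃ → (prodBernoulli w).real (openConn a₃ b) ≤ (prodBernoulli w).real (openConn a₁ b) → (prodBernoulli w).real (openConn a₃ b) ≤ (prodBernoulli w).real (openConn a₂ b) → (prodBernoulli w).real (openConn a₁ b) ≤ (prodBernoulli w).real (openConn a₃ b) → (prodBernoulli w).real (openConn o b) < (prodBernoulli w).real (openConn a₃ b) → (prodBernoulli w).real ((openConn a₁ a₃)ᶜ ∩ (openConn a₂ a₃)ᶜ ∩ (openConn a₁ b ∩ openConn a₂ b)) < (prodBernoulli w).real ((openConn a₁ a₃)ᶜ ∩ (openConn a₂ a₃)ᶜ ∩ openConn a₃ b) → 0 ≤ (prodBernoulli w).real ((openConn a₁ a₃)ᶜ ∩ (openConn a₂ a₃)ᶜ ∩ (openConn a₁ o ∪ openConn a₂ o)) * (prodBernoulli w).real ((openConn a₁ a₂)ᶜ ∩ (openConn a₁ a₃)ᶜ : Set (BondConfig (Fin n))) * (prodBernoulli w).real ((openConn a₂ a₁)ᶜ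 ∩ (openConn a₂ a₃)ᶜ : Set (BondConfig (Fin n))) * ((prodBernoulli w).real ((openConn a₁ a₃)ᶜ ∩ (openConn a₂ a₃)ᶜ ∩ (openConn a₁ b ∩ openConn a₂ b)) - (prodBernoulli w).real ((openConn a₁ a₃)ᶜ ∩ (openConn a₂ a₃)ᶜ ∩ openConn a₃ b)) + (prodBernoulli w).real ((openConn a₁ a₂)ᶜ ∩ (openConn a₁ a₃)ᶜ ∩ openConn a₁ o) * (prodBernoulli w).real ((openConn a₁ a₃)ᶜ ∩ (openConn a₂ a₃)ᶜ : Set (BondConfig (Fin n))) * (prodBernoulli w).real ((openConn a₂ a₁)ᶜ ∩ (openConn a₂ a₃)ᶜ : Set (BondConfig (Fin n))) * ((prodBernoulli w).real ((openConn a₁ a₂)ᶜ ∩ (openConn a₁ a₃)ᶜ ∩ openConn a₁ b) - (prodBernoulli w).real ((openConn a₁ a₂)ᶜ ∩ (openConn a₁ a₃)ᶜ ∩ (openConn a₂ b ∩ openConn a₃ b))) + (prodBernoulli w).real ((openConn a₂ a₁)ᶜ ∩ (openConn a₂ a₃)ᶜ ∩ openConn a₂ o) * (prodBernoulli w).real ((openConn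 a₁ a₃)ᶜ ∩ (openConn a₂ a₃)ᶜ : Set (BondConfig (Fin n))) * (prodBernoulli w).real ((openConn a₁ a₂)ᶜ ∩ (openConn a₁ a₃)ᶜ : Set (BondConfig (Fin n))) * ((prodBernoulli w).real ((openConn a₂ a₁)ᶜ ∩ (openConn a₂ a₃)ᶜ ∩ openConn a₂ b) - (prodBernoulli w).real ((openConn a₂ a₁)ᶜ ∩ (openConn a₂ a₃)ᶜ ∩ (openConn a₁ b ∩ openConn a₃ b))) + (prodBernoulli w).real ((openConn a₁ a₂)ᶜ ∩ (openConn a₁ a₃)ᶜ : Set (BondConfig (Fin n))) * (prodBernoulli w).real ((openConn a₂ a₁)ᶜ ∩ (openConn a₂ a₃)ᶜ : Set (BondConfig (Fin n))) * (prodBernoulli w).real ((openConn a₁ a₃)ᶜ ∩ (openConn a₂ a₃)ᶜ : Set (BondConfig (Fin n))) * (prodBernoulli w).real ((openConn o a₁ ∪ openConn o a₂ ∪ openConn o a₃)ᶜ ∩ (openConn a₃ b)ᶜ : Set (BondConfig (Fin n)))) :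
    ∀ (n : ℕ) (w : Sym2 (Fin n) → unitInterval) (A : Finset (Fin n)) (o b : Fin n) (t : ℝ),
      (A.erase b).card ≤ 3 → 0 ≤ t →
      (∀ a ∈ A, 1 - t ≤ (prodBernoulli w).real (openConn a b)) →
      (prodBernoulli w).real (⋃ a ∈ A, openConn o a) - t ≤ (prodBernoulli w).real (openConn o b) := by
  intro n w A o b t hcard ht hrel
  by_cases hsmall : (A.erase b).card ≤ 2
  · -- at most two relays besides `b`: deep seat r2's assembly never uses the certificate there, but its statement takes it;
    -- we redo the two-relay bookkeeping via the landed `additiveGluing_of_erase_card_le_three_of_regionCert` applied with a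
    -- VACUOUS relay triple is not possible, so we call the landed two-relay theorems directly.
    have hm : ∀ s : Set (BondConfig (Fin n)), MeasurableSet s := fun _ => MeasurableSet.of_discrete
    have hU1 : (prodBernoulli w).real (⋃ a ∈ A, (openConn o a : Set (BondConfig (Fin n)))) ≤ 1 := measureReal_le_one
    by_cases hoA : o ∈ A
    · have h := hrel o hoA
      have hoo : (openConn o o : Set (BondConfig (Fin n))) = Set.univ :=
        Set.eq_univ_of_forall fun ω => (SimpleGraph.Reachable.refl o : (openGraph ω).Reachable o o)
      have : (prodBernoulli w).real (openConn o o : Set (BondConfig (Fin n))) ≤ (prodBernoulli w).real (openConn o b) +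
          (prodBernoulli w).real ((openConn o o : Set (BondConfig (Fin n))) \ openConn o b) := by
        have := measureReal_inter_add_sdiff (μ := prodBernoulli w) (s := (openConn o o : Set (BondConfig (Fin n)))) (hm (openConn o b))
        have h2 : (prodBernoulli w).real ((openConn o o : Set (BondConfig (Fin n))) ∩ openConn o b) ≤
            (prodBernoulli w).real (openConn o b : Set (BondConfig (Fin n))) := measureReal_mono Set.inter_subset_right
        linarith
      have h3 := tieRed_sdiff_le_one_sub w o o b
      rw [hoo, probReal_univ] at this
      rw [hoo] at h3
      linarith
    by_cases hbA : b ∈ A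
    · have hA3 : A.card ≤ 3 := by
        have := Finset.card_erase_of_mem hbA; omega
      have hK := stub_goodCardLeThree_k42 n w A o b hbA hoA hA3 t (fun _ => b) (fun _ => hbA) hrel
      have hP : 0 ≤ ∑ W ∈ (Finset.univ : Finset (Finset (Fin n))).filter (fun W => o ∈ W ∧ Disjoint W A),
          (prodBernoulli w).real {ω : BondConfig (Fin n) | openCluster ω o = (W : Set (Fin n))} *
            (prodBernoulli w).real (openConnIn ((W : Set (Fin n))ᶜ) b b)ᶜ :=
        Finset.sum_nonneg fun W _ => mul_nonneg measureReal_nonneg measureReal_nonneg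
      have h1 := measureReal_inter_add_sdiff (μ := prodBernoulli w) (s := ⋃ a ∈ A, openConn o a) (hm (openConn o b))
        (h := measure_ne_top _ _)
      have h2 : (prodBernoulli w).real ((⋃ a ∈ A, openConn o a) ∩ openConn o b) ≤
          (prodBernoulli w).real (openConn o b : Set (BondConfig (Fin n))) := measureReal_mono Set.inter_subset_right
      have h3 : ((⋃ a ∈ A, openConn o a) \ openConn o b : Set (BondConfig (Fin n))) =
          (⋃ a ∈ A, openConn o a) ∩ (openConn o b)ᶜ := Set.sdiff_eq _ _
      rw [h3] at h1
      linarith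
    · have hA2 : A.card ≤ 2 := by rwa [Finset.erase_eq_of_notMem hbA] at hsmall
      exact additiveGluing_of_card_le_two n w A o b t hA2 ht hrel
  -- exactly three relays besides `b`: reduce to the tie locus
  have h3 : (A.erase b).card = 3 := by omega
  refine additiveGluing_pointwise_of_minTie n A o b ?_ w t ht hrel
  intro w' htie' t' ht' hrel'
  obtain ⟨a, ha, a', ha', hne, heq, hmin⟩ := htie'
  have hm : ∀ s : Set (BondConfig (Fin n)), MeasurableSet s := fun _ => MeasurableSet.of_discrete
  -- decomposition `μ(o↔A) ≤ μ(o↔b) + μ(o↔A ∖ o↔b)`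
  have hsplit : (prodBernoulli w').real (⋃ c ∈ A, (openConn o c : Set (BondConfig (Fin n)))) ≤
      (prodBernoulli w').real (openConn o b : Set (BondConfig (Fin n))) +
        (prodBernoulli w').real ((⋃ c ∈ A, (openConn o c : Set (BondConfig (Fin n)))) \ openConn o b) := by
    have h1 := measureReal_inter_add_sdiff (μ := prodBernoulli w') (s := ⋃ c ∈ A, (openConn o c : Set (BondConfig (Fin n))))
      (hm (openConn o b)) (h := measure_ne_top _ _)
    have h2 : (prodBernoulli w').real ((⋃ c ∈ A, (openConn o c : Set (BondConfig (Fin n)))) ∩ openConn o b) ≤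
        (prodBernoulli w').real (openConn o b : Set (BondConfig (Fin n))) := measureReal_mono Set.inter_subset_right
    linarith
  -- if the minimum is `1`, every relay is a.s. joined to `b`: union bound
  by_cases hone : (prodBernoulli w').real (openConn a b) = 1
  · have hnull : (prodBernoulli w').real ((⋃ c ∈ A, (openConn o c : Set (BondConfig (Fin n)))) \ openConn o b) ≤ 0 := by
      have hsub : ((⋃ c ∈ A, (openConn o c : Set (BondConfig (Fin n)))) \ openConn o b) ⊆
          ⋃ c ∈ A, ((openConn o c : Set (BondConfig (Fin n))) \ openConn o b) := by
        intro ω hω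
        simp only [Set.mem_sdiff, Set.mem_iUnion] at hω ⊢
        obtain ⟨⟨c, hc, hoc⟩, hob⟩ := hω
        exact ⟨c, hc, hoc, hob⟩
      refine (measureReal_mono hsub (measure_ne_top _ _)).trans ((measureReal_biUnion_finset_le A _).trans ?_)
      refine Finset.sum_nonpos fun c hc => ?_
      have h1 := tieRed_sdiff_le_one_sub w' o c b
      have h2 := hmin c hc
      have h3 : (prodBernoulli w').real (openConn c b : Set (BondConfig (Fin n))) ≤ 1 := measureReal_le_one
      linarith
    linarith
  -- otherwise the tied minimal relays are not `b`
  have hab : a ≠ b := by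
    rintro rfl
    have : (openConn a a : Set (BondConfig (Fin n))) = Set.univ :=
      Set.eq_univ_of_forall fun ω => (SimpleGraph.Reachable.refl a : (openGraph ω).Reachable a a)
    rw [this, probReal_univ] at hone
    exact hone rfl
  have ha'b : a' ≠ b := by
    rintro rfl
    have : (openConn a' a' : Set (BondConfig (Fin n))) = Set.univ :=
      Set.eq_univ_of_forall fun ω => (SimpleGraph.Reachable.refl a' : (openGraph ω).Reachable a' a')
    rw [this, probReal_univ] at heq
    exact hone heq
  have haS : a ∈ A.erase b := Finset.mem_erase.2 ⟨hab, ha⟩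
  have ha'S : a' ∈ A.erase b := Finset.mem_erase.2 ⟨ha'b, ha'⟩
  -- the third relay `y`
  have hT : ((A.erase b).erase a).erase a' = (((A.erase b).erase a).erase a') := rfl
  have hTcard : (((A.erase b).erase a).erase a').card = 1 := by
    have h1 : ((A.erase b).erase a).card = 2 := by rw [Finset.card_erase_of_mem haS]; omega
    have ha'T : a' ∈ (A.erase b).erase a := Finset.mem_erase.2 ⟨hne.symm, ha'S⟩
    rw [Finset.card_erase_of_mem ha'T]; omega
  obtain ⟨y, hy⟩ := Finset.card_eq_one.1 hTcard
  have hyT : y ∈ ((A.erase b).erase a).erase a' := by rw [hy]; exact Finset.mem_singleton_self y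
  obtain ⟨hya', hyT'⟩ := Finset.mem_erase.1 hyT
  obtain ⟨hya, hyS⟩ := Finset.mem_erase.1 hyT'
  obtain ⟨hyb, hyA⟩ := Finset.mem_erase.1 hyS
  have hcover : ∀ c ∈ A.erase b, c = a ∨ c = a' ∨ c = y := by
    intro c hc
    by_cases hca : c = a
    · exact Or.inl hca
    by_cases hca' : c = a'
    · exact Or.inr (Or.inl hca')
    have : c ∈ ((A.erase b).erase a).erase a' := Finset.mem_erase.2 ⟨hca', Finset.mem_erase.2 ⟨hca, hc⟩⟩
    rw [hy] at this
    exact Or.inr (Or.inr (Finset.mem_singleton.1 this))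
  -- the tie-locus E-form with `a₁ = a'`, `a₂ = y`, `a₃ = a`
  have hE := additiveGluing_threeRelays_of_tieRegionCert hcert n w' o b a' y a t' hya'.symm hne.symm hya
    (hrel' a ha) (hmin a' ha') (hmin y hyA) (le_of_eq heq.symm)
  have hsub : ((⋃ c ∈ A, (openConn o c : Set (BondConfig (Fin n)))) \ openConn o b) ⊆
      (openConn o a' ∪ openConn o y ∪ openConn o a) \ openConn o b := by
    intro ω hω
    simp only [Set.mem_sdiff, Set.mem_iUnion] at hω
    obtain ⟨⟨c, hcA, hoc⟩, hob⟩ := hω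
    refine ⟨?_, hob⟩
    have hcb : c ≠ b := by rintro rfl; exact hob hoc
    rcases hcover c (Finset.mem_erase.2 ⟨hcb, hcA⟩) with rfl | rfl | rfl
    · exact Or.inr hoc
    · exact Or.inl (Or.inl hoc)
    · exact Or.inl (Or.inr hoc)
  have hle := measureReal_mono (μ := prodBernoulli w') hsub (measure_ne_top _ _)
  linarith

end

end Summit.CriticalPhenomena.PercolationContinuityZ3.Theorems
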